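import Literature.Geometry.Riemannian.AHNormalizationOffBoundary
import Literature.Geometry.Riemannian.GaussBonnetGradient
import Literature.Geometry.Riemannian.ConformallyCompactFillingTopology
import Literature.Geometry.Riemannian.CutLocusProofs
import Literature.Geometry.Manifold.MaximalFlowContinuity
import Literature.Geometry.Manifold.CompleteFlow
import Literature.Topology.FourManifolds.InteriorConnected
import Mathlib.Analysis.SpecialFunctions.SmoothTransition
import Mathlib.Analysis.SpecialFunctions.Integrals.Basic
import Mathlib.MeasureTheory.Integral.IntervalIntegral.FundThmCalculus
import HarnessLib

/-!
# Distance function vs. defining function on a conformally compact filling: the upper bound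

Support file (everything proved, no definitions, no named facts) for the proof of
`Literature.Geometry.Riemannian.liQingShi_pinching_five` (Li–Qing–Shi 2017, Thm. 1.8), companion of
`AHDistanceLowerBound.lean`: the half `t ≤ r + C` of the comparison "`u = r − t` is bounded"
(Li–Qing–Shi 2017, p. 11) between the distance function `t = dist_g(p₀, ·)` of the bulk metric
and `r = −log ρ`, in the setting of the filling package (`j : N → X` a smooth embedding onto the
interior of the compact connected `X`, `ρ ≥ 0` smooth vanishing exactly on `∂X`,
`j^* ḡ = (ρ ∘ j)² g`, `|dρ|_ḡ = 1` on `∂X`).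

* `exists_path_to_level` — **every point of the collar is joined to the core by a short path**:
  there are a level `a > 0` and `C ≥ 0` such that every bulk point `q` with `u(q) = ρ(j q) < a`
  is at distance `≤ log a − log u(q) + C` from a point of the level `{u = a}`. Proof: the
  normalised gradient field `V = ψ(u) · grad_g u / |grad_g u|²_g` (`ψ` a smooth cutoff, `= 1` on
  `{u ≤ a}`) is smooth, `du(V) = ψ(u)`, and `|V|_g ≤ ((1 − C₁ u) u)⁻¹` on `{u ≤ a}` by the
  propagated normalisation `|du|_g ≥ (1 − C₁ u) u`
  (`ConformallyCompact.exists_normalization_off_boundary`); along its maximal integral curve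
  from `q` (the tree's maximal flow, `Literature.Geometry.Manifold.exists_maximalFlow_contMDiffOn`)
  `u` increases at unit rate, the curve stays in the compact `{u(q) ≤ u ≤ a}` and therefore
  reaches the level `a` (uniform existence time on compact sets, escape lemma), and its length is
  `≤ ∫₀^{a − u(q)} (1/(u(q) + t) + 2 C₁) dt = log a − log u(q) + O(1)`.
* `exists_edist_le_sub_log_sub_log` — hence, the core `{u ≥ a}` being compact in the connected
  bulk, **`d_g(p, q) ≤ C − log u(p) − log u(q)`** for all bulk points; with
  `AHDistanceLowerBound.exists_log_sub_log_sub_le_edist` this is `|t + log (ρ ∘ j)| ≤ C(p₀)`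
  for `t = d_g(p₀, ·)`; `exists_rho_le_exp_sub_edist` is the consequence
  `ρ(j x) ≤ exp (C − d_g(p₀, x))` that converts the curvature decay `|K + 1| ≤ C₀ ρ²`
  (Li–Qing–Shi 2017, Lemma 1.6) into the decay `≤ C e^{−2t}` in the distance used in §6 there.

## References

* G. Li, J. Qing, Y. Shi, *Gap phenomena and curvature estimates for conformally compact
  Einstein manifolds*, Trans. AMS 369 (2017), p. 11. [LiQingShi2017]
* R. Mazzeo, J. Diff. Geom. 28 (1988), §1.
* J. M. Lee, *Introduction to Smooth Manifolds*, 2nd ed. (2012), Thm. 9.12, Lemma 9.19.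
  [LeeSmoothManifolds2013]
-/

noncomputable section

open Bundle Set Filter Function Metric TopologicalSpace Manifold MeasureTheory
open scoped Manifold ContDiff Topology ENNReal NNReal

namespace Literature.Geometry.Riemannian

namespace ConformallyCompact

open Literature.Geometry.Lorentzian
open Literature.Geometry.Lorentzian.PseudoRiemannianMetric
open SimpleAH Literature.Geometry.Manifold

set_option maxSynthPendingDepth 3

/-! ### One-variable lemmas -/

section Elementary

/-- `((1 − C y) y)⁻¹ ≤ y⁻¹ + 2 C` for `y > 0`, `C ≥ 0`, `C y ≤ 1/2`. [folklore] -/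
theorem inv_one_sub_mul_mul_le {C y : ℝ} (hC : 0 ≤ C) (hy : 0 < y) (hCy : C * y ≤ 1 / 2) :
    ((1 - C * y) * y)⁻¹ ≤ y⁻¹ + 2 * C := by
  have hpos : 0 < (1 - C * y) * y := mul_pos (by linarith) hy
  rw [inv_le_iff_one_le_mul₀ hpos]
  have e1 : (y⁻¹ + 2 * C) * ((1 - C * y) * y) = (1 - C * y) * (y⁻¹ * y) + 2 * (C * y) * (1 - C * y) := by
    ring
  rw [e1, inv_mul_cancel₀ hy.ne', mul_one]
  nlinarith [mul_nonneg hC hy.le]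

/-- `∫₀ᵀ ((b + t)⁻¹ + 2 C) dt = log (b + T) − log b + 2 C T` for `b > 0`, `T ≥ 0`. [folklore] -/
theorem integral_inv_add_const {b T C : ℝ} (hb : 0 < b) (hT : 0 ≤ T) :
    ∫ t in (0 : ℝ)..T, ((b + t)⁻¹ + 2 * C) = Real.log (b + T) - Real.log b + 2 * C * T := by
  have hderiv : ∀ t ∈ uIcc (0 : ℝ) T,
      HasDerivAt (fun t ↦ Real.log (b + t) + 2 * C * t) ((b + t)⁻¹ + 2 * C) t := by
    intro t ht
    rw [uIcc_of_le hT] at ht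
    have hbt : 0 < b + t := by linarith [ht.1]
    have h1 : HasDerivAt (fun t ↦ Real.log (b + t)) ((b + t)⁻¹) t := by
      have h := ((hasDerivAt_id t).const_add b).log hbt.ne'
      simpa using h
    have h2 : HasDerivAt (fun t ↦ 2 * C * t) (2 * C) t := by
      simpa using (hasDerivAt_id t).const_mul (2 * C)
    exact h1.add h2
  have hcont : ContinuousOn (fun t : ℝ ↦ (b + t)⁻¹ + 2 * C) (uIcc 0 T) := by
    rw [uIcc_of_le hT]
    refine ContinuousOn.add (ContinuousOn.inv₀ (by fun_prop) fun t ht ↦ ?_) continuousOn_const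
    have : 0 < b + t := by linarith [ht.1]
    exact this.ne'
  rw [intervalIntegral.integral_eq_sub_of_hasDerivAt hderiv (hcont.intervalIntegrable)]
  simp only [add_zero, mul_zero]
  ring

end Elementary

/-! ### A short path from the collar to the core -/

section Flow

variable {n : ℕ}
  {N : Type*} [TopologicalSpace N] [T2Space N] [ChartedSpace (EuclideanSpace ℝ (Fin (n + 1))) N]
  [IsManifold (𝓡 (n + 1)) ∞ N]
  {X : Type*} [TopologicalSpace X] [ChartedSpace (EuclideanHalfSpace (n + 1)) X]
  [IsManifold (𝓡∂ (n + 1)) ∞ X] [CompactSpace X]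

set_option maxHeartbeats 3200000 in
/-- **Every point of the collar is joined to the core by a short path** (the gradient-flow
half of Li–Qing–Shi 2017, p. 11, "`u = r − t` is bounded"; Mazzeo 1988, §1). In the setting
of the module docstring there are `a > 0` and `C ≥ 0` such that for every bulk point `q` with
`ρ(j q) < a` there is a bulk point `y` on the level `ρ(j y) = a` with
`d_g(q, y) ≤ log a − log ρ(j q) + C`. [cite: LiQingShi2017, p. 11] -/
theorem exists_path_to_level {n' : ℕ∞ω}
    (G : PseudoRiemannianMetric (𝓡 (n + 1)) ∞ (EuclideanSpace ℝ (Fin (n + 1)))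
      (TangentSpace (𝓡 (n + 1)) : N → Type _)) (hG : G.IsRiemannian)
    (gb : PseudoRiemannianMetric (𝓡∂ (n + 1)) n' (EuclideanSpace ℝ (Fin (n + 1)))
      (TangentSpace (𝓡∂ (n + 1)) : X → Type _)) (hn' : 1 ≤ n') (hgb : gb.IsRiemannian)
    {j : N → X} (hj : Manifold.IsSmoothEmbedding (𝓡 (n + 1)) (𝓡∂ (n + 1)) ∞ j)
    (hjr : range j = (𝓡∂ (n + 1)).interior X)
    {ρ : X → ℝ} (hρ : ContMDiff (𝓡∂ (n + 1)) 𝓘(ℝ, ℝ) ∞ ρ) (hρ0 : ∀ x, 0 ≤ ρ x)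
    (hρb : ∀ x, ρ x = 0 ↔ x ∈ (𝓡∂ (n + 1)).boundary X)
    (hconf : ∀ (x : N) (v w : TangentSpace (𝓡 (n + 1)) x),
      gb.val (j x) (mfderiv (𝓡 (n + 1)) (𝓡∂ (n + 1)) j x v) (mfderiv (𝓡 (n + 1)) (𝓡∂ (n + 1)) j x w)
        = ρ (j x) ^ 2 * G.val x v w)
    {B : Type*} (ι : B → X) (hιr : range ι = (𝓡∂ (n + 1)).boundary X)
    (hν : ∀ y : B, ∃ ν : TangentSpace (𝓡∂ (n + 1)) (ι y), gb.val (ι y) ν ν = 1 ∧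
      ∀ a : TangentSpace (𝓡∂ (n + 1)) (ι y), gb.val (ι y) ν a = mfderiv (𝓡∂ (n + 1)) 𝓘(ℝ, ℝ) ρ (ι y) a) :
    ∃ a C : ℝ, 0 < a ∧ 0 ≤ C ∧ ∀ q : N, ρ (j q) < a →
      ∃ y : N, ρ (j y) = a ∧
        G.edist hG q y ≤ ENNReal.ofReal (Real.log a - Real.log (ρ (j q)) + C) := by
  letI := G.riemannianBundle hG
  obtain ⟨κ, C₁, hκ, hC₁, hN⟩ :=
    exists_normalization_off_boundary G gb hn' hgb hj hjr hρ hρ0 hρb hconf ι hιr hν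
  -- the function `u = ρ ∘ j`
  set u : N → ℝ := fun x ↦ ρ (j x) with hu
  have hpos_range : ∀ y : X, 0 < ρ y → y ∈ range j := by
    intro y hy
    rw [hjr, ← ModelWithCorners.compl_boundary]
    exact fun hb ↦ hy.ne' ((hρb y).2 hb)
  have hupos : ∀ x, 0 < u x := by
    intro x
    have hx : j x ∈ (𝓡∂ (n + 1)).interior X := hjr ▸ mem_range_self x
    have hnb : j x ∉ (𝓡∂ (n + 1)).boundary X := fun hb ↦
      Set.disjoint_left.1 ModelWithCorners.disjoint_interior_boundary hx hb
    exact lt_of_le_of_ne (hρ0 _) fun h0 ↦ hnb ((hρb _).1 h0.symm)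
  have husmooth : ContMDiff (𝓡 (n + 1)) 𝓘(ℝ, ℝ) ∞ u := hρ.comp hj.contMDiff
  have hucont : Continuous u := husmooth.continuous
  have hud : ∀ x, MDifferentiableAt (𝓡 (n + 1)) 𝓘(ℝ, ℝ) u x :=
    fun x ↦ (husmooth x).mdifferentiableAt (by simp)
  have hcpt : ∀ s : ℝ, 0 < s → IsCompact {x : N | s ≤ u x} := fun s hs ↦
    isCompact_setOf_le_comp_of_isEmbedding hj.isEmbedding hρ.continuous hpos_range hs
  -- shrink `κ` so that `C₁ u ≤ 1/2` on the collar
  set κ₀ : ℝ := min κ (1 / (2 * (C₁ + 1))) with hκ₀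
  have hκ₀pos : 0 < κ₀ := lt_min hκ (by positivity)
  have hκ₀κ : κ₀ ≤ κ := min_le_left _ _
  have hC₁κ₀ : C₁ * κ₀ ≤ 1 / 2 := by
    have h1 : κ₀ ≤ 1 / (2 * (C₁ + 1)) := min_le_right _ _
    have h2 : C₁ * (1 / (2 * (C₁ + 1))) ≤ 1 / 2 := by
      rw [mul_one_div, div_le_div_iff₀ (by positivity) (by positivity)]
      nlinarith
    exact (mul_le_mul_of_nonneg_left h1 hC₁).trans h2
  have hC₁u : ∀ x, u x ≤ κ₀ → C₁ * u x ≤ 1 / 2 := fun x hx ↦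
    (mul_le_mul_of_nonneg_left hx hC₁).trans hC₁κ₀
  -- the gradient field `W = grad u` and `Qf = g(W, W)`
  set W : Π x : N, TangentSpace (𝓡 (n + 1)) x := grad G u with hW
  have hWs : ContMDiff (𝓡 (n + 1)) ((𝓡 (n + 1)).prod 𝓘(ℝ, EuclideanSpace ℝ (Fin (n + 1)))) ∞
      (fun x ↦ TotalSpace.mk' (EuclideanSpace ℝ (Fin (n + 1))) x (W x)) := contMDiff_grad G husmooth
  have hWval : ∀ (x : N) (w : TangentSpace (𝓡 (n + 1)) x),
      G.val x (W x) w = mvfderiv (𝓡 (n + 1)) u x w := fun x w ↦ val_grad G u x w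
  set Qf : N → ℝ := fun x ↦ G.val x (W x) (W x) with hQf
  have hQs : ContMDiff (𝓡 (n + 1)) 𝓘(ℝ, ℝ) ∞ Qf := fun x ↦
    G.contMDiffAt_val_apply le_rfl (hWs x) (hWs x)
  have hGnonneg : ∀ (x : N) (v : TangentSpace (𝓡 (n + 1)) x), 0 ≤ G.val x v v := by
    intro x v
    by_cases hv : v = 0
    · rw [hv]; simp
    · exact (hG x v hv).le
  -- the lower bound `g(W, W) ≥ ((1 - C₁ u) u)²` on the collar `{u < κ₀}`
  have hQlow : ∀ x, u x < κ₀ → 0 < (1 - C₁ * u x) * u x ∧ ((1 - C₁ * u x) * u x) ^ 2 ≤ Qf x := by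
    intro x hx
    obtain ⟨-, v, hv1, hv2⟩ := hN x (hx.trans_le hκ₀κ)
    have hCS := sq_apply_le_mul_apply_of_nonneg (G.val x) (fun a b ↦ G.symm x a b) (hGnonneg x)
      (W x) v
    rw [hv1, mul_one, hWval] at hCS
    have h1 : 0 < (1 - C₁ * u x) * u x :=
      mul_pos (by linarith [hC₁u x hx.le]) (hupos x)
    exact ⟨h1, (pow_le_pow_left₀ h1.le hv2 2).trans hCS⟩
  have hQpos : ∀ x, u x < κ₀ → 0 < Qf x := fun x hx ↦
    (pow_pos (hQlow x hx).1 2).trans_le (hQlow x hx).2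
  -- the cutoff `ψ`: `= 1` on `(-∞, a]`, `= 0` on `[3κ₀/4, ∞)`, `a = κ₀/2`
  set a : ℝ := κ₀ / 2 with ha
  have hapos : 0 < a := half_pos hκ₀pos
  have haκ₀ : a < κ₀ := half_lt_self hκ₀pos
  set ψ : ℝ → ℝ := fun s ↦ Real.smoothTransition (3 - 4 * s / κ₀) with hψ
  have hψ1 : ∀ s, s ≤ a → ψ s = 1 := by
    intro s hs
    apply Real.smoothTransition.one_of_one_le
    have : 4 * s / κ₀ ≤ 2 := by
      rw [div_le_iff₀ hκ₀pos]; linarith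
    linarith
  have hψ0 : ∀ s, 3 * κ₀ / 4 ≤ s → ψ s = 0 := by
    intro s hs
    apply Real.smoothTransition.zero_of_nonpos
    have : 3 ≤ 4 * s / κ₀ := by
      rw [le_div_iff₀ hκ₀pos]; linarith
    linarith
  have hψle : ∀ s, ψ s ≤ 1 := fun s ↦ Real.smoothTransition.le_one _
  have hψnn : ∀ s, 0 ≤ ψ s := fun s ↦ Real.smoothTransition.nonneg _
  have hψs : ContDiff ℝ ∞ ψ :=
    Real.smoothTransition.contDiff.comp
      (contDiff_const.sub ((contDiff_const.mul contDiff_id).div_const κ₀))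
  -- the coefficient `c = ψ(u) / Qf` and the field `V = c • W`
  set c : N → ℝ := fun x ↦ ψ (u x) * (Qf x)⁻¹ with hc
  have hcs : ContMDiff (𝓡 (n + 1)) 𝓘(ℝ, ℝ) ∞ c := by
    intro x
    by_cases hx : u x < κ₀
    · have h1 : ContMDiffAt (𝓡 (n + 1)) 𝓘(ℝ, ℝ) ∞ (fun y ↦ ψ (u y)) x :=
        hψs.contDiffAt.comp_contMDiffAt (husmooth x)
      have h2 : ContMDiffAt (𝓡 (n + 1)) 𝓘(ℝ, ℝ) ∞ (fun y ↦ (Qf y)⁻¹) x :=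
        (contDiffAt_inv ℝ (hQpos x hx).ne').comp_contMDiffAt (hQs x)
      exact h1.mul h2
    · have hopen : IsOpen {y : N | 3 * κ₀ / 4 < u y} := isOpen_lt continuous_const hucont
      have hxmem : x ∈ {y : N | 3 * κ₀ / 4 < u y} := by
        show 3 * κ₀ / 4 < u x
        linarith [not_lt.1 hx]
      have hev : c =ᶠ[𝓝 x] fun _ ↦ 0 := by
        filter_upwards [hopen.mem_nhds hxmem] with y hy
        show ψ (u y) * (Qf y)⁻¹ = 0
        rw [hψ0 (u y) (le_of_lt hy), zero_mul]
      exact contMDiffAt_const.congr_of_eventuallyEq hev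
  set V : Π x : N, TangentSpace (𝓡 (n + 1)) x := c • W with hV
  have hVapp : ∀ x, V x = c x • W x := fun x ↦ rfl
  have hVs : ContMDiff (𝓡 (n + 1)) ((𝓡 (n + 1)).prod 𝓘(ℝ, EuclideanSpace ℝ (Fin (n + 1)))) ∞
      (fun x ↦ TotalSpace.mk' (EuclideanSpace ℝ (Fin (n + 1))) x (V x)) := hcs.smul_section hWs
  -- `du(V) = ψ(u)`
  have hduV : ∀ x, mvfderiv (𝓡 (n + 1)) u x (V x) = ψ (u x) := by
    intro x
    rw [hVapp, map_smul, smul_eq_mul, ← hWval]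
    show ψ (u x) * (Qf x)⁻¹ * Qf x = ψ (u x)
    by_cases hx : u x < κ₀
    · rw [mul_assoc, inv_mul_cancel₀ (hQpos x hx).ne', mul_one]
    · rw [hψ0 (u x) (by linarith [not_lt.1 hx]), zero_mul, zero_mul]
  -- `g(V, V) ≤ ((1 - C₁ u) u)⁻²` on `{u ≤ a}`
  have hVnorm : ∀ x, u x ≤ a → G.val x (V x) (V x) ≤ (((1 - C₁ * u x) * u x) ^ 2)⁻¹ := by
    intro x hx
    have hxκ : u x < κ₀ := hx.trans_lt haκ₀
    obtain ⟨hpos', hlow⟩ := hQlow x hxκ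
    have hQ0 := hQpos x hxκ
    have hcx : c x = (Qf x)⁻¹ := by
      show ψ (u x) * (Qf x)⁻¹ = (Qf x)⁻¹
      rw [hψ1 _ hx, one_mul]
    rw [hVapp, map_smul, map_smul, smul_apply, smul_eq_mul, smul_eq_mul, hcx]
    show (Qf x)⁻¹ * ((Qf x)⁻¹ * Qf x) ≤ _
    rw [inv_mul_cancel₀ hQ0.ne', mul_one]
    exact inv_anti₀ (pow_pos hpos' 2) hlow
  -- the maximal flow of `V`
  have hVs1 : ContMDiff (𝓡 (n + 1)) (𝓡 (n + 1)).tangent ((⊤ : ℕ∞) : ℕ∞ω)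
      (fun x ↦ (⟨x, V x⟩ : TangentBundle (𝓡 (n + 1)) N)) := hVs
  obtain ⟨Θ, D, hΘ, -, -, hΘs⟩ :=
    exists_maximalFlow_contMDiffOn (I := 𝓡 (n + 1)) hVs1 le_top
  -- the constants
  refine ⟨a, 2 * C₁ * a, hapos, by positivity, fun q hq ↦ ?_⟩
  have hq' : u q < a := hq
  obtain ⟨hDo, hDc, h0D, hΘ0, hΘint, hmax⟩ := hΘ q
  set θ : ℝ → N := Θ q with hθ
  set Dq : Set ℝ := D q with hDq
  set T : ℝ := a - u q with hT
  have hTpos : 0 < T := by rw [hT]; linarith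
  have hTa : T ≤ a := by rw [hT]; linarith [hupos q]
  -- derivative of `u ∘ θ`
  have hderiv : ∀ t ∈ Dq, HasDerivAt (fun s ↦ u (θ s)) (ψ (u (θ t))) t := by
    intro t ht
    have h1 : HasMFDerivAt 𝓘(ℝ, ℝ) (𝓡 (n + 1)) θ t
        ((1 : ℝ →L[ℝ] ℝ).smulRight (V (θ t))) := hΘint.hasMFDerivAt_of_isOpen hDo ht
    have h2 := (hud (θ t)).hasMFDerivAt.comp t h1
    set L : ℝ →L[ℝ] ℝ := (mfderiv (𝓡 (n + 1)) 𝓘(ℝ, ℝ) u (θ t)).comp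
      ((1 : ℝ →L[ℝ] ℝ).smulRight (V (θ t))) with hL
    have h3 : HasFDerivAt (fun s ↦ u (θ s)) L t := hasMFDerivAt_iff_hasFDerivAt.1 h2
    have h4 : HasDerivAt (fun s ↦ u (θ s)) (L 1) t := h3.hasDerivAt
    refine h4.congr_deriv ?_
    show mvfderiv (𝓡 (n + 1)) u (θ t) ((1 : ℝ) • V (θ t)) = ψ (u (θ t))
    rw [one_smul, hduV]
  -- along the flow `u` increases at unit rate up to the level `a`
  have hflow : ∀ t ∈ Dq, 0 ≤ t → t ≤ T → u (θ t) = u q + t := by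
    intro t ht ht0 htT
    have hsub : Icc 0 t ⊆ Dq := hDc.out h0D ht
    have hcont : ContinuousOn (fun s ↦ u (θ s)) (Icc 0 t) :=
      fun s hs ↦ (hderiv s (hsub hs)).continuousAt.continuousWithinAt
    have hdiff : DifferentiableOn ℝ (fun s ↦ u (θ s)) (interior (Icc 0 t)) := by
      rw [interior_Icc]
      exact fun s hs ↦ (hderiv s (hsub (Ioo_subset_Icc_self hs))).differentiableAt.differentiableWithinAt
    have hder_eq : ∀ s ∈ Ioo 0 t, deriv (fun s ↦ u (θ s)) s = ψ (u (θ s)) :=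
      fun s hs ↦ (hderiv s (hsub (Ioo_subset_Icc_self hs))).deriv
    have h0 : u (θ 0) = u q := by rw [hΘ0]
    -- first `u (θ s) ≤ u q + s`
    have hup : ∀ s ∈ Icc 0 t, u (θ s) ≤ u q + s := by
      intro s hs
      have hle1 : ∀ r ∈ interior (Icc 0 t), deriv (fun s ↦ u (θ s)) r ≤ 1 := by
        rw [interior_Icc]
        intro r hr
        rw [hder_eq r hr]
        exact hψle _
      have h := (convex_Icc 0 t).image_sub_le_mul_sub_of_deriv_le hcont hdiff hle1 0
        (left_mem_Icc.2 ht0) s hs hs.1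
      rw [h0] at h
      linarith
    -- hence `ψ (u (θ s)) = 1` and the derivative is `1`
    have hge1 : ∀ r ∈ interior (Icc 0 t), (1 : ℝ) ≤ deriv (fun s ↦ u (θ s)) r := by
      rw [interior_Icc]
      intro r hr
      rw [hder_eq r hr, hψ1 _ (by linarith [hup r (Ioo_subset_Icc_self hr), hr.2])]
    have h := (convex_Icc 0 t).mul_sub_le_image_sub_of_le_deriv hcont hdiff hge1 0
      (left_mem_Icc.2 ht0) t (right_mem_Icc.2 ht0) ht0
    rw [h0] at h
    have h' := hup t (right_mem_Icc.2 ht0)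
    linarith
  -- the flow reaches the level `a`: `T ∈ Dq` (escape lemma)
  have hTD : T ∈ Dq := by
    by_contra hTD
    have hlt : ∀ t ∈ Dq, t < T := by
      intro t ht
      by_contra hle
      push Not at hle
      exact hTD (hDc.out h0D ht ⟨hTpos.le, hle⟩)
    have hbdd : BddAbove Dq := ⟨T, fun t ht ↦ (hlt t ht).le⟩
    set S := sSup Dq with hS
    have hK : IsCompact ({x : N | u q ≤ u x} ∩ {x : N | u x ≤ a}) :=
      (hcpt (u q) (hupos q)).inter_right (isClosed_le hucont continuous_const)
    obtain ⟨ε, hε, hunif⟩ := exists_uniform_time_of_isCompact (I := 𝓡 (n + 1)) hVs1 le_top hK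
    obtain ⟨t₁, ht₁D, ht₁⟩ := exists_lt_of_lt_csSup ⟨0, h0D⟩ (show S - ε / 2 < S by linarith)
    set t₂ : ℝ := max t₁ 0 with ht₂
    have ht₂D : t₂ ∈ Dq := by
      rcases le_total t₁ 0 with h | h
      · rw [ht₂, max_eq_right h]; exact h0D
      · rw [ht₂, max_eq_left h]; exact ht₁D
    have ht₂S : S - ε / 2 < t₂ := ht₁.trans_le (le_max_left _ _)
    have ht₂0 : 0 ≤ t₂ := le_max_right _ _
    have ht₂T : t₂ < T := hlt t₂ ht₂D
    have hut₂ := hflow t₂ ht₂D ht₂0 ht₂T.le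
    have hθt₂ : θ t₂ ∈ {x : N | u q ≤ u x} ∩ {x : N | u x ≤ a} := by
      constructor
      · show u q ≤ u (θ t₂)
        rw [hut₂]; linarith
      · show u (θ t₂) ≤ a
        rw [hut₂]; linarith
    obtain ⟨γ₁, hγ₁0, hγ₁⟩ := hunif (θ t₂) hθt₂
    have hγ₂ : IsMIntegralCurveOn (γ₁ ∘ (· - t₂)) V {t | t - t₂ ∈ Ioo (-ε) ε} :=
      isMIntegralCurveOn_comp_sub.2 hγ₁
    have hJ : {t : ℝ | t - t₂ ∈ Ioo (-ε) ε} = Ioo (t₂ - ε) (t₂ + ε) := by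
      ext t; constructor
      · rintro ⟨h1, h2⟩; exact ⟨by linarith, by linarith⟩
      · rintro ⟨h1, h2⟩; exact ⟨by linarith, by linarith⟩
    rw [hJ] at hγ₂
    have hsub := (hmax (γ₁ ∘ (· - t₂)) (Ioo (t₂ - ε) (t₂ + ε)) isOpen_Ioo ordConnected_Ioo t₂
      ⟨by linarith, by linarith⟩ ht₂D (by simp [hγ₁0]) hγ₂).1
    have hmem : t₂ + ε / 2 ∈ Dq := hsub ⟨by linarith, by linarith⟩
    have := le_csSup hbdd hmem
    linarith
  -- the curve `θ|[0, T]` is `C¹`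
  have hIcc : Icc 0 T ⊆ Dq := hDc.out h0D hTD
  have hθsm : ContMDiffOn 𝓘(ℝ, ℝ) (𝓡 (n + 1)) ((⊤ : ℕ∞) : ℕ∞ω) θ Dq := by
    have h1 : ContMDiff 𝓘(ℝ, ℝ) ((𝓡 (n + 1)).prod 𝓘(ℝ, ℝ)) ((⊤ : ℕ∞) : ℕ∞ω)
        (fun t : ℝ ↦ ((q, t) : N × ℝ)) := contMDiff_const.prodMk contMDiff_id
    exact hΘs.comp h1.contMDiffOn fun t ht ↦ (ht : t ∈ D q)
  have hθ1 : ContMDiffOn 𝓘(ℝ, ℝ) (𝓡 (n + 1)) 1 θ (Icc 0 T) := (hθsm.of_le (by simp)).mono hIcc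
  -- the velocity and its size
  have hθ' : ∀ t ∈ Dq, mfderiv 𝓘(ℝ, ℝ) (𝓡 (n + 1)) θ t 1 = V (θ t) := by
    intro t ht
    rw [(hΘint.hasMFDerivAt_of_isOpen hDo ht).mfderiv]
    show (1 : ℝ) • V (θ t) = V (θ t)
    exact one_smul _ _
  have hbound : ∀ t ∈ Icc 0 T,
      Real.sqrt (G.val (θ t) (mfderiv 𝓘(ℝ, ℝ) (𝓡 (n + 1)) θ t 1)
        (mfderiv 𝓘(ℝ, ℝ) (𝓡 (n + 1)) θ t 1)) ≤ (u q + t)⁻¹ + 2 * C₁ := by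
    intro t ht
    rw [hθ' t (hIcc ht)]
    have hut : u (θ t) = u q + t := hflow t (hIcc ht) ht.1 ht.2
    have hle : u (θ t) ≤ a := by rw [hut]; linarith [ht.2]
    have hy : 0 < u (θ t) := hupos _
    have hC₁y : C₁ * u (θ t) ≤ 1 / 2 := hC₁u _ (hle.trans haκ₀.le)
    have hpos' : 0 < (1 - C₁ * u (θ t)) * u (θ t) := (hQlow _ (hle.trans_lt haκ₀)).1
    calc Real.sqrt (G.val (θ t) (V (θ t)) (V (θ t)))
        ≤ Real.sqrt ((((1 - C₁ * u (θ t)) * u (θ t)) ^ 2)⁻¹) := Real.sqrt_le_sqrt (hVnorm _ hle)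
      _ = ((1 - C₁ * u (θ t)) * u (θ t))⁻¹ := by
          rw [Real.sqrt_inv, Real.sqrt_sq hpos'.le]
      _ ≤ (u (θ t))⁻¹ + 2 * C₁ := inv_one_sub_mul_mul_le hC₁ hy hC₁y
      _ = (u q + t)⁻¹ + 2 * C₁ := by rw [hut]
  -- the length of `θ|[0, T]`
  have hlen : G.length hG θ 0 T ≤
      ENNReal.ofReal (Real.log a - Real.log (u q) + 2 * C₁ * T) := by
    have hcontφ : ContinuousOn (fun t : ℝ ↦ (u q + t)⁻¹ + 2 * C₁) (Icc 0 T) := by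
      refine ContinuousOn.add (ContinuousOn.inv₀ (by fun_prop) fun t ht ↦ ?_) continuousOn_const
      have : 0 < u q + t := by linarith [ht.1, hupos q]
      exact this.ne'
    have hnn : 0 ≤ᵐ[volume.restrict (Icc (0 : ℝ) T)] fun t : ℝ ↦ (u q + t)⁻¹ + 2 * C₁ := by
      rw [EventuallyLE, ae_restrict_iff' measurableSet_Icc]
      refine Eventually.of_forall fun t ht ↦ ?_
      have : 0 < u q + t := by linarith [ht.1, hupos q]
      show (0 : ℝ) ≤ (u q + t)⁻¹ + 2 * C₁
      positivity
    rw [length_eq_lintegral]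
    calc ∫⁻ t in Icc 0 T, ENNReal.ofReal (Real.sqrt (G.val (θ t)
          (mfderiv 𝓘(ℝ, ℝ) (𝓡 (n + 1)) θ t 1) (mfderiv 𝓘(ℝ, ℝ) (𝓡 (n + 1)) θ t 1)))
        ≤ ∫⁻ t in Icc 0 T, ENNReal.ofReal ((u q + t)⁻¹ + 2 * C₁) :=
          setLIntegral_mono' measurableSet_Icc fun t ht ↦ ENNReal.ofReal_le_ofReal (hbound t ht)
      _ = ENNReal.ofReal (∫ t in Icc 0 T, ((u q + t)⁻¹ + 2 * C₁)) :=
          (ofReal_integral_eq_lintegral_ofReal (hcontφ.integrableOn_Icc) hnn).symm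
      _ = ENNReal.ofReal (Real.log (u q + T) - Real.log (u q) + 2 * C₁ * T) := by
          rw [integral_Icc_eq_integral_Ioc, ← intervalIntegral.integral_of_le hTpos.le,
            integral_inv_add_const (hupos q) hTpos.le]
      _ = ENNReal.ofReal (Real.log a - Real.log (u q) + 2 * C₁ * T) := by
          rw [show u q + T = a by rw [hT]; ring]
  -- the endpoint
  refine ⟨θ T, ?_, ?_⟩
  · show u (θ T) = a
    rw [hflow T hTD hTpos.le le_rfl, hT]
    ring
  · have h0 : θ 0 = q := hΘ0
    calc G.edist hG q (θ T) = G.edist hG (θ 0) (θ T) := by rw [h0]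
      _ ≤ G.length hG θ 0 T := edist_le_length hG hTpos.le hθ1
      _ ≤ ENNReal.ofReal (Real.log a - Real.log (u q) + 2 * C₁ * T) := hlen
      _ ≤ ENNReal.ofReal (Real.log a - Real.log (ρ (j q)) + 2 * C₁ * a) := by
          apply ENNReal.ofReal_le_ofReal
          have : 2 * C₁ * T ≤ 2 * C₁ * a := mul_le_mul_of_nonneg_left hTa (by positivity)
          show Real.log a - Real.log (u q) + 2 * C₁ * T ≤ Real.log a - Real.log (u q) + 2 * C₁ * a
          linarith

end Flow

/-! ### The upper bound `t ≤ r + C` -/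

section UpperBound

variable {n : ℕ}
  {N : Type*} [TopologicalSpace N] [T2Space N] [ChartedSpace (EuclideanSpace ℝ (Fin (n + 1))) N]
  [IsManifold (𝓡 (n + 1)) ∞ N]
  {X : Type*} [TopologicalSpace X] [ChartedSpace (EuclideanHalfSpace (n + 1)) X]
  [IsManifold (𝓡∂ (n + 1)) ∞ X] [CompactSpace X] [ConnectedSpace X]

set_option maxHeartbeats 800000 in
/-- **`−log ρ` dominates the distance function up to a constant** (Li–Qing–Shi 2017, p. 11:
"`u = r − t` is bounded", the half `t ≤ r + C`). In the setting of the module docstring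
(`X` compact and connected) there is `C` with `d_g(p, q) ≤ C − log ρ(j p) − log ρ(j q)` for all
bulk points `p, q`; in particular `t = d_g(p₀, ·) ≤ −log (ρ ∘ j) + C(p₀)`.
[cite: LiQingShi2017, p. 11] -/
theorem exists_edist_le_sub_log_sub_log {n' : ℕ∞ω}
    (G : PseudoRiemannianMetric (𝓡 (n + 1)) ∞ (EuclideanSpace ℝ (Fin (n + 1)))
      (TangentSpace (𝓡 (n + 1)) : N → Type _)) (hG : G.IsRiemannian)
    (gb : PseudoRiemannianMetric (𝓡∂ (n + 1)) n' (EuclideanSpace ℝ (Fin (n + 1)))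
      (TangentSpace (𝓡∂ (n + 1)) : X → Type _)) (hn' : 1 ≤ n') (hgb : gb.IsRiemannian)
    {j : N → X} (hj : Manifold.IsSmoothEmbedding (𝓡 (n + 1)) (𝓡∂ (n + 1)) ∞ j)
    (hjr : range j = (𝓡∂ (n + 1)).interior X)
    {ρ : X → ℝ} (hρ : ContMDiff (𝓡∂ (n + 1)) 𝓘(ℝ, ℝ) ∞ ρ) (hρ0 : ∀ x, 0 ≤ ρ x)
    (hρb : ∀ x, ρ x = 0 ↔ x ∈ (𝓡∂ (n + 1)).boundary X)
    (hconf : ∀ (x : N) (v w : TangentSpace (𝓡 (n + 1)) x),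
      gb.val (j x) (mfderiv (𝓡 (n + 1)) (𝓡∂ (n + 1)) j x v) (mfderiv (𝓡 (n + 1)) (𝓡∂ (n + 1)) j x w)
        = ρ (j x) ^ 2 * G.val x v w)
    {B : Type*} (ι : B → X) (hιr : range ι = (𝓡∂ (n + 1)).boundary X)
    (hν : ∀ y : B, ∃ ν : TangentSpace (𝓡∂ (n + 1)) (ι y), gb.val (ι y) ν ν = 1 ∧
      ∀ a : TangentSpace (𝓡∂ (n + 1)) (ι y), gb.val (ι y) ν a = mfderiv (𝓡∂ (n + 1)) 𝓘(ℝ, ℝ) ρ (ι y) a) :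
    ∃ C : ℝ, ∀ p q : N,
      G.edist hG p q ≤ ENNReal.ofReal (C - Real.log (ρ (j p)) - Real.log (ρ (j q))) := by
  obtain ⟨a, C₀, ha, hC₀, hpath⟩ :=
    exists_path_to_level G hG gb hn' hgb hj hjr hρ hρ0 hρb hconf ι hιr hν
  set u : N → ℝ := fun x ↦ ρ (j x) with hu
  have hpos_range : ∀ y : X, 0 < ρ y → y ∈ range j := by
    intro y hy
    rw [hjr, ← ModelWithCorners.compl_boundary]
    exact fun hb ↦ hy.ne' ((hρb y).2 hb)
  have hupos : ∀ x, 0 < u x := by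
    intro x
    have hx : j x ∈ (𝓡∂ (n + 1)).interior X := hjr ▸ mem_range_self x
    have hnb : j x ∉ (𝓡∂ (n + 1)).boundary X := fun hb ↦
      Set.disjoint_left.1 ModelWithCorners.disjoint_interior_boundary hx hb
    exact lt_of_le_of_ne (hρ0 _) fun h0 ↦ hnb ((hρb _).1 h0.symm)
  have hucont : Continuous u := hρ.continuous.comp hj.contMDiff.continuous
  -- an upper bound `u ≤ ρmax`, `ρmax ≥ 1`
  obtain ⟨R, hR⟩ := isCompact_univ.exists_bound_of_continuousOn (f := ρ) hρ.continuous.continuousOn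
  set ρmax : ℝ := max R 1 with hρmax
  have hρmax0 : 0 < ρmax := one_pos.trans_le (le_max_right _ _)
  have huρ : ∀ x, u x ≤ ρmax := fun x ↦
    ((le_abs_self _).trans ((Real.norm_eq_abs _).symm.trans_le (hR (j x) (mem_univ _)))).trans
      (le_max_left _ _)
  -- `N` is preconnected (the interior of the connected `X`)
  haveI : PreconnectedSpace N := by
    have h1 : IsPreconnected ((𝓡∂ (n + 1)).interior X) :=
      Literature.Topology.FourManifolds.isPreconnected_interior
    rw [← hjr, ← image_univ] at h1
    exact ⟨(hj.isEmbedding.isInducing.isPreconnected_image).1 h1⟩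
  haveI : LocallyCompactSpace N := Manifold.locallyCompact_of_finiteDimensional (𝓡 (n + 1))
  haveI : RegularSpace N := inferInstance
  -- the core and its diameter
  set K₀ : Set N := {x | a ≤ u x} with hK₀
  have hK₀c : IsCompact K₀ :=
    isCompact_setOf_le_comp_of_isEmbedding hj.isEmbedding hρ.continuous hpos_range ha
  obtain ⟨Dm, hDmtop, hDm⟩ : ∃ Dm : ℝ≥0∞, Dm < ⊤ ∧ ∀ x ∈ K₀, ∀ y ∈ K₀, G.edist hG x y ≤ Dm := by
    by_cases hne : (K₀ ×ˢ K₀).Nonempty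
    · obtain ⟨z, -, hmax⟩ := (hK₀c.prod hK₀c).exists_isMaxOn hne
        (PseudoRiemannianMetric.continuous_edist hG).continuousOn
      exact ⟨G.edist hG z.1 z.2, edist_lt_top hG _ _, fun x hx y hy ↦ hmax (mk_mem_prod hx hy)⟩
    · exact ⟨0, ENNReal.zero_lt_top, fun x hx y hy ↦ (hne ⟨(x, y), mk_mem_prod hx hy⟩).elim⟩
  -- every point is joined to the core
  set c₁ : ℝ := Real.log a + C₀ + max 0 (Real.log ρmax - Real.log a) with hc₁
  have hc₁nn : ∀ x, 0 ≤ c₁ - Real.log (u x) := by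
    intro x
    have h1 : Real.log (u x) ≤ Real.log ρmax := Real.log_le_log (hupos x) (huρ x)
    have h2 : Real.log ρmax - Real.log a ≤ max 0 (Real.log ρmax - Real.log a) := le_max_right _ _
    rw [hc₁]; linarith
  have hjoin : ∀ x : N, ∃ y ∈ K₀, G.edist hG x y ≤ ENNReal.ofReal (c₁ - Real.log (u x)) := by
    intro x
    by_cases hx : u x < a
    · obtain ⟨y, hy, hxy⟩ := hpath x hx
      refine ⟨y, le_of_eq hy.symm, hxy.trans (ENNReal.ofReal_le_ofReal ?_)⟩
      have : (0 : ℝ) ≤ max 0 (Real.log ρmax - Real.log a) := le_max_left _ _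
      show Real.log a - Real.log (u x) + C₀ ≤ c₁ - Real.log (u x)
      rw [hc₁]; linarith
    · refine ⟨x, not_lt.1 hx, ?_⟩
      rw [PseudoRiemannianMetric.edist_self]
      exact bot_le
  -- assembly
  set dm : ℝ := Dm.toReal with hdm
  have hdm0 : 0 ≤ dm := ENNReal.toReal_nonneg
  have hDm' : Dm = ENNReal.ofReal dm := (ENNReal.ofReal_toReal hDmtop.ne).symm
  refine ⟨2 * c₁ + dm, fun p q ↦ ?_⟩
  obtain ⟨yp, hyp, hp⟩ := hjoin p
  obtain ⟨yq, hyq, hq⟩ := hjoin q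
  have hq' : G.edist hG yq q ≤ ENNReal.ofReal (c₁ - Real.log (u q)) := by
    rwa [PseudoRiemannianMetric.edist_comm]
  calc G.edist hG p q ≤ G.edist hG p yp + G.edist hG yp q :=
        PseudoRiemannianMetric.edist_triangle hG _ _ _
    _ ≤ G.edist hG p yp + (G.edist hG yp yq + G.edist hG yq q) :=
        add_le_add le_rfl (PseudoRiemannianMetric.edist_triangle hG _ _ _)
    _ ≤ ENNReal.ofReal (c₁ - Real.log (u p)) + (Dm + ENNReal.ofReal (c₁ - Real.log (u q))) :=
        add_le_add hp (add_le_add (hDm yp hyp yq hyq) hq')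
    _ = ENNReal.ofReal (c₁ - Real.log (u p)) +
          (ENNReal.ofReal dm + ENNReal.ofReal (c₁ - Real.log (u q))) := by rw [hDm']
    _ = ENNReal.ofReal (2 * c₁ + dm - Real.log (ρ (j p)) - Real.log (ρ (j q))) := by
        rw [← ENNReal.ofReal_add hdm0 (hc₁nn q),
          ← ENNReal.ofReal_add (hc₁nn p) (add_nonneg hdm0 (hc₁nn q))]
        congr 1
        show c₁ - Real.log (u p) + (dm + (c₁ - Real.log (u q))) =
          2 * c₁ + dm - Real.log (u p) - Real.log (u q)
        ring

/-- **Exponential decay of the defining function in the distance from a base point**: for every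
`p₀` there is `C` with `ρ(j x) ≤ exp (C − d_g(p₀, x))` for all bulk points `x` — the form in which
"`u = r − t` is bounded" converts the decay `|K + 1| ≤ C₀ ρ²` of Li–Qing–Shi 2017, Lemma 1.6
into the decay `|K + 1| ≤ C e^{−2t}` in the distance `t` used in §6 there.
[cite: LiQingShi2017, p. 11 and Lemma 1.6] -/
theorem exists_rho_le_exp_sub_edist {n' : ℕ∞ω}
    (G : PseudoRiemannianMetric (𝓡 (n + 1)) ∞ (EuclideanSpace ℝ (Fin (n + 1)))
      (TangentSpace (𝓡 (n + 1)) : N → Type _)) (hG : G.IsRiemannian)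
    (gb : PseudoRiemannianMetric (𝓡∂ (n + 1)) n' (EuclideanSpace ℝ (Fin (n + 1)))
      (TangentSpace (𝓡∂ (n + 1)) : X → Type _)) (hn' : 1 ≤ n') (hgb : gb.IsRiemannian)
    {j : N → X} (hj : Manifold.IsSmoothEmbedding (𝓡 (n + 1)) (𝓡∂ (n + 1)) ∞ j)
    (hjr : range j = (𝓡∂ (n + 1)).interior X)
    {ρ : X → ℝ} (hρ : ContMDiff (𝓡∂ (n + 1)) 𝓘(ℝ, ℝ) ∞ ρ) (hρ0 : ∀ x, 0 ≤ ρ x)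
    (hρb : ∀ x, ρ x = 0 ↔ x ∈ (𝓡∂ (n + 1)).boundary X)
    (hconf : ∀ (x : N) (v w : TangentSpace (𝓡 (n + 1)) x),
      gb.val (j x) (mfderiv (𝓡 (n + 1)) (𝓡∂ (n + 1)) j x v) (mfderiv (𝓡 (n + 1)) (𝓡∂ (n + 1)) j x w)
        = ρ (j x) ^ 2 * G.val x v w)
    {B : Type*} (ι : B → X) (hιr : range ι = (𝓡∂ (n + 1)).boundary X)
    (hν : ∀ y : B, ∃ ν : TangentSpace (𝓡∂ (n + 1)) (ι y), gb.val (ι y) ν ν = 1 ∧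
      ∀ a : TangentSpace (𝓡∂ (n + 1)) (ι y), gb.val (ι y) ν a = mfderiv (𝓡∂ (n + 1)) 𝓘(ℝ, ℝ) ρ (ι y) a)
    (p₀ : N) :
    ∃ C : ℝ, ∀ x : N, ρ (j x) ≤ Real.exp (C - (G.edist hG p₀ x).toReal) := by
  obtain ⟨C₀, hC₀⟩ :=
    exists_edist_le_sub_log_sub_log G hG gb hn' hgb hj hjr hρ hρ0 hρb hconf ι hιr hν
  have hupos : ∀ x : N, 0 < ρ (j x) := by
    intro x
    have hx : j x ∈ (𝓡∂ (n + 1)).interior X := hjr ▸ mem_range_self x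
    have hnb : j x ∉ (𝓡∂ (n + 1)).boundary X := fun hb ↦
      Set.disjoint_left.1 ModelWithCorners.disjoint_interior_boundary hx hb
    exact lt_of_le_of_ne (hρ0 _) fun h0 ↦ hnb ((hρb _).1 h0.symm)
  obtain ⟨R, hR⟩ := isCompact_univ.exists_bound_of_continuousOn (f := ρ) hρ.continuous.continuousOn
  set ρmax : ℝ := max R 1 with hρmax
  have hρmax0 : 0 < ρmax := one_pos.trans_le (le_max_right _ _)
  have huρ : ∀ x : N, ρ (j x) ≤ ρmax := fun x ↦
    ((le_abs_self _).trans ((Real.norm_eq_abs _).symm.trans_le (hR (j x) (mem_univ _)))).trans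
      (le_max_left _ _)
  refine ⟨max (C₀ - Real.log (ρ (j p₀))) (Real.log ρmax), fun x ↦ ?_⟩
  set b : ℝ := C₀ - Real.log (ρ (j p₀)) - Real.log (ρ (j x)) with hb
  have hx := hC₀ p₀ x
  by_cases hb0 : 0 ≤ b
  · -- `t ≤ b`, so `log u(x) ≤ C₀ − log u(p₀) − t`
    have ht : (G.edist hG p₀ x).toReal ≤ b := ENNReal.toReal_le_of_le_ofReal hb0 hx
    calc ρ (j x) = Real.exp (Real.log (ρ (j x))) := (Real.exp_log (hupos x)).symm
      _ ≤ Real.exp (max (C₀ - Real.log (ρ (j p₀))) (Real.log ρmax) - (G.edist hG p₀ x).toReal) := by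
          apply Real.exp_le_exp.2
          have : C₀ - Real.log (ρ (j p₀)) ≤ max (C₀ - Real.log (ρ (j p₀))) (Real.log ρmax) :=
            le_max_left _ _
          rw [hb] at ht
          linarith
  · -- degenerate case: the distance vanishes
    push Not at hb0
    have h0 : G.edist hG p₀ x = 0 := by
      have : ENNReal.ofReal b = 0 := ENNReal.ofReal_of_nonpos hb0.le
      rw [this] at hx
      exact le_antisymm hx bot_le
    rw [h0, ENNReal.toReal_zero, sub_zero]
    calc ρ (j x) ≤ ρmax := huρ x
      _ = Real.exp (Real.log ρmax) := (Real.exp_log hρmax0).symm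
      _ ≤ Real.exp (max (C₀ - Real.log (ρ (j p₀))) (Real.log ρmax)) :=
          Real.exp_le_exp.2 (le_max_right _ _)

end UpperBound

end ConformallyCompact

end Literature.Geometry.Riemannian

end
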